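import Summits.QuantumFields.YangMills.Theorems.BalabanUVNodesN08HaarCompatibilityGuardJacobianContractionOperator

/-!
# BalabanUVNodes ∕ N08 — THE TWO-SIDED JACOBIAN PINCH AT DETERMINANT LEVEL (part 3c): `(1 − Σcᵢ)^dim ≤ |det T| ≤ (1 − Σᵢcᵢ(1 − ψρᵢ))^dim ≤ 1`
# for the left-trivialised tangent map `T X = K_W* · D K_W (W X)` on `𝔲(N)` (dim `N²`) and on `𝔰𝔲(N)` (dim `N² − 1`, typed guard `deltaSU`)

WIDTH SEAT `pub-ymgap-dag-n08-w6` g4 (R399 (3a) second wave; CLAIM-2 ∕ INTENT-3 of record HOME INBOX l.32241), 2026-08-28.  Track A, DAG node N08 =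
[Balaban1985UV3] Thm 1 p. 257 (compact) + Thm 2 p. 272; key item K1⁷ `StabilityBAtRecordR13SepCoPH` (stmt-QuantumFields-20542), `--supports … --as helper`.
COUNT-NEUTRAL.

WHAT THIS FILE PROVES ([folklore]).  §1 `abs_det_le_pow_finrank_of_norm_le_mul`: an `ℝ`-linear endomorphism of a finite-dimensional real normed space (any norm)
with `‖f x‖ ≤ κ‖x‖`, `κ ≥ 0`, has `|det f| ≤ κ^dim` (Haar measure of balls, the mirror of part 1's floor lemma; `κ = 0` by `LinearMap.det_zero`).  §2 the same in
`hs`-form on pub-balaban's `lieU` ∕ `lieSU` (pinned Hilbert–Schmidt norms; exponents `N²`, `N² − 1`).  §3 for EVERY `ℝ`-linear `T` agreeing with `K_W* · D K_W(W ·)`: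
★★ `abs_det_leftTangent_le` ∕ `abs_det_leftTangentSU_le` (`|det T| ≤ (1 − Σᵢcᵢ(1 − ψρᵢ))^dim` from part 3b's `emlD_tangent_upper_bound`, `K_W*·` an hs-isometry),
`kappa_bounds` (`0 ≤ 1 − Σcᵢ ≤ κ ≤ 1`), and the PINCH ★★★ `abs_det_leftTangent_pinch` (`𝔲(N)`: `(1 − Σcᵢ)^(N²) ≤ |det T| ≤ 1`), ★★★ `abs_det_leftTangentSU_pinch`
(`𝔰𝔲(N)`, `W, hᵢ ∈ SU(N)`, guard `deltaSU`: `(1 − Σcᵢ)^(N² − 1) ≤ |det T| ≤ 1`) + the typed reading `…_specialUnitary` — the lower ends are parts 1∕2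
(p616149 ∕ p617624).  READING: the Haar-Jacobian of the printed one-variable fibre map is, per bond, between `L^{(1−d)·dim}` (`1 − Σcᵢ = L^{1−d}` at the [B10] slot)
and `1`; a density constant of the guarded branch therefore needs only the floor and a sheet count, never an expansion allowance.

HONEST FRAMING.  Count-neutral helper; NO quantitative `T4Haar*LocalDiffeo`, NO density bound, NO sheet count, NO injectivity window typed; nothing of Bałaban's
asserted; E6′ NOT decided; `hmass` NOT supplied; N08 NOT discharged; counts unmoved (typed 28∕28 · discharged 5∕27); no summit statement is proved by this seat —
one finite 𝕋⁴ programme at fixed ε, R4 closes the CONDITIONAL rung `BalabanLadder.UV` only; the Yang–Mills mass gap (Clay) is NOT proved by any of this; nothing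
continuum ∕ ℝ⁴ ∕ OS.  0 `sorry`, 0 `def`, 0 `instance`, 0 `notation`, standard axioms.
-/

noncomputable section

open NormedSpace Finset
open scoped Matrix ComplexConjugate

namespace Summit.QuantumFields.YangMills.BalabanUVNodes.N08HaarCompatibilityGuardJacobianContractionDet

open Literature.MathematicalPhysics.QuantumFieldTheory.Balaban1983to89
open Literature.MathematicalPhysics.QuantumFieldTheory.Balaban1983to89.T4EMLTangentInjective
open Literature.MathematicalPhysics.QuantumFieldTheory.Balaban1983to89.T4AdjointCovarianceUnitary
  (lieU lieSU mem_lieU_iff mem_lieSU_iff)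
open Summit.QuantumFields.YangMills.BalabanUVNodes.N08HaarCompatibilityGuardJacobianDet
open Summit.QuantumFields.YangMills.BalabanUVNodes.N08HaarCompatibilityGuardJacobianDetSU
open Summit.QuantumFields.YangMills.BalabanUVNodes.N08HaarCompatibilityGuardJacobianContractionFrame
open Summit.QuantumFields.YangMills.BalabanUVNodes.N08HaarCompatibilityGuardJacobianContractionOperator
open Matrix (unitaryGroup specialUnitaryGroup)
open Literature.MathematicalPhysics.QuantumFieldTheory.Balaban1983to89.MatrixLog (mlog)
open T4QuatExpLog (ψ)

/-! ## §1 [folklore] A contracting endomorphism has a small determinant: `‖f x‖ ≤ κ‖x‖ ⟹ |det f| ≤ κ^dim` -/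

section Generic

open MeasureTheory Metric Module

variable {E : Type*} [NormedAddCommGroup E] [NormedSpace ℝ E] [FiniteDimensional ℝ E]

/-- **A contracting endomorphism has a small determinant.**  If `f` is an `ℝ`-linear endomorphism of a finite-dimensional real normed space
(ANY norm) with `‖f x‖ ≤ κ‖x‖`, `κ ≥ 0`, then `|det f| ≤ κ^(dim E)`: `f(ball 0 1) ⊆ ball 0 κ`, so `|det f|·vol(ball 0 1) = vol(f(ball 0 1)) ≤ κ^dim·vol(ball 0 1)`
(Mathlib's `addHaar_image_linearMap`, `addHaar_ball_of_pos`); `κ = 0` forces `f = 0` (`LinearMap.det_zero`).  The mirror image of part 1's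
`pow_finrank_le_abs_det_of_mul_norm_le`. [folklore] -/
theorem abs_det_le_pow_finrank_of_norm_le_mul (f : E →ₗ[ℝ] E) {κ : ℝ} (hκ : 0 ≤ κ) (hf : ∀ x, ‖f x‖ ≤ κ * ‖x‖) :
    |LinearMap.det f| ≤ κ ^ finrank ℝ E := by
  rcases hκ.eq_or_lt with h0 | hκ0
  · have hf0 : f = 0 := LinearMap.ext fun x => by
      have h1 := hf x
      rw [← h0, zero_mul] at h1
      simpa using norm_le_zero_iff.1 h1
    rw [hf0, LinearMap.det_zero, ← h0, abs_of_nonneg (pow_nonneg le_rfl _)]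
  · borelize E
    let μ : Measure E := (Module.finBasis ℝ E).addHaar
    have hball : f '' ball (0 : E) 1 ⊆ ball 0 κ := by
      rintro _ ⟨x, hx, rfl⟩
      rw [mem_ball_zero_iff] at hx ⊢
      calc ‖f x‖ ≤ κ * ‖x‖ := hf x
        _ < κ * 1 := mul_lt_mul_of_pos_left hx hκ0
        _ = κ := mul_one κ
    have h1 : μ (f '' ball 0 1) ≤ μ (ball (0 : E) κ) := measure_mono hball
    rw [Measure.addHaar_ball_of_pos μ _ hκ0, Measure.addHaar_image_linearMap] at h1
    have hB0 : μ (ball (0 : E) 1) ≠ 0 := (measure_ball_pos μ (0 : E) one_pos).ne'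
    have hBtop : μ (ball (0 : E) 1) ≠ ⊤ := measure_ball_lt_top.ne
    have h2 : ENNReal.ofReal |LinearMap.det f| ≤ ENNReal.ofReal (κ ^ finrank ℝ E) :=
      (ENNReal.mul_le_mul_iff_left hB0 hBtop).1 h1
    exact (ENNReal.ofReal_le_ofReal_iff (pow_nonneg hκ _)).1 h2

end Generic

/-! ## §2 §1 in Hilbert–Schmidt form on pub-balaban's `𝔲(N)` and `𝔰𝔲(N)` -/

section Lie

open Module

variable {m : Type*} [Fintype m] [DecidableEq m]

/-- `hs(TX, TX) ≤ κ²·hs(X, X)` on `𝔲(N)` ⟹ `|det T| ≤ κ^(N²)`. [folklore] -/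
theorem abs_det_le_pow_card_sq_of_hs_le (T : lieU m →ₗ[ℝ] lieU m) {κ : ℝ} (hκ : 0 ≤ κ)
    (hT : ∀ X : lieU m, hs ((T X : lieU m) : Matrix m m ℂ) ((T X : lieU m) : Matrix m m ℂ)
      ≤ κ ^ 2 * hs (X : Matrix m m ℂ) (X : Matrix m m ℂ)) :
    |LinearMap.det T| ≤ κ ^ (Fintype.card m ^ 2) := by
  rw [← finrank_lieU]
  refine abs_det_le_pow_finrank_of_norm_le_mul T hκ fun X => ?_
  have h1 : ‖T X‖ ^ 2 ≤ (κ * ‖X‖) ^ 2 := by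
    rw [mul_pow, norm_sq_eq_hs, norm_sq_eq_hs]; exact hT X
  exact (pow_le_pow_iff_left₀ (norm_nonneg _) (mul_nonneg hκ (norm_nonneg _)) two_ne_zero).1 h1

/-- `hs(TX, TX) ≤ κ²·hs(X, X)` on `𝔰𝔲(N)` ⟹ `|det T| ≤ κ^(N² − 1)`. [folklore] -/
theorem abs_det_le_pow_card_sq_sub_one_of_hs_le (T : lieSU m →ₗ[ℝ] lieSU m) {κ : ℝ} (hκ : 0 ≤ κ)
    (hT : ∀ X : lieSU m, hs ((T X : lieSU m) : Matrix m m ℂ) ((T X : lieSU m) : Matrix m m ℂ)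
      ≤ κ ^ 2 * hs (X : Matrix m m ℂ) (X : Matrix m m ℂ)) :
    |LinearMap.det T| ≤ κ ^ (Fintype.card m ^ 2 - 1) := by
  rw [← finrank_lieSU]
  refine abs_det_le_pow_finrank_of_norm_le_mul T hκ fun X => ?_
  have h1 : ‖T X‖ ^ 2 ≤ (κ * ‖X‖) ^ 2 := by
    rw [mul_pow, norm_sq_eq_hs_lieSU, norm_sq_eq_hs_lieSU]; exact hT X
  exact (pow_le_pow_iff_left₀ (norm_nonneg _) (mul_nonneg hκ (norm_nonneg _)) two_ne_zero).1 h1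

end Lie

/-! ## §3 THE TWO-SIDED PINCH FOR THE LEFT-TRIVIALISED TANGENT MAP `T X = K_W* · D K_W (W X)` -/

section EML

open scoped Matrix.Norms.L2Operator

variable {m : Type*} [Fintype m] [DecidableEq m] [Nonempty m] {ι : Type*} [Fintype ι]

omit [Nonempty m] in
/-- The contraction constant lies in `[1 − Σcᵢ, 1] ⊆ [0, 1]`: for `cᵢ ≥ 0`, `Σcᵢ ≤ 1`, `0 ≤ ρᵢ ≤ 1`,
`0 ≤ 1 − Σcᵢ ≤ 1 − Σᵢ cᵢ(1 − ψρᵢ) ≤ 1` (`0 ≤ 1 − ψρ ≤ 1` on `[0, 1]`). [folklore] -/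
theorem kappa_bounds {c : ι → ℝ} (hc0 : ∀ i, 0 ≤ c i) (hc1 : ∑ i, c i ≤ 1) {ρ : ι → ℝ} (hρ0 : ∀ i, 0 ≤ ρ i)
    (hρ1 : ∀ i, ρ i ≤ 1) :
    1 - ∑ i, c i ≤ 1 - ∑ i, c i * (1 - ψ (ρ i)) ∧ 0 ≤ 1 - ∑ i, c i * (1 - ψ (ρ i)) ∧ 1 - ∑ i, c i * (1 - ψ (ρ i)) ≤ 1 := by
  have habs : ∀ i, |ρ i| ≤ 1 := fun i => by rw [abs_of_nonneg (hρ0 i)]; exact hρ1 i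
  have hψ0 : ∀ i, 0 ≤ ψ (ρ i) := fun i => ψ_nonneg_of_abs_lt_pi ((habs i).trans_lt (by linarith [Real.pi_gt_three]))
  have hψ1 : ∀ i, ψ (ρ i) ≤ 1 := fun i => ψ_le_one_of_abs_le_one (habs i)
  have h1 : ∑ i, c i * (1 - ψ (ρ i)) ≤ ∑ i, c i := Finset.sum_le_sum fun i _ => by nlinarith [hc0 i, hψ0 i]
  have h2 : 0 ≤ ∑ i, c i * (1 - ψ (ρ i)) := Finset.sum_nonneg fun i _ => mul_nonneg (hc0 i) (by linarith [hψ1 i])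
  exact ⟨by linarith, by linarith, by linarith⟩

/-- ★★ **UPPER DETERMINANT BOUND ON `𝔲(N)`.**  For unitary `W`, unitaries `hᵢ` in the guard `‖hᵢW* − 1‖ < 1∕2`, `cᵢ ≥ 0`, `Σcᵢ ≤ 1`,
radii `‖log(hᵢW*)‖ ≤ ρᵢ ≤ 1`, and every `ℝ`-linear endomorphism `T` of `𝔲(N)` agreeing with `K_W* · D K_W (W ·)`:
  `|det T| ≤ (1 − Σᵢ cᵢ(1 − ψρᵢ))^(N²)`. [folklore] -/
theorem abs_det_leftTangent_le {h : ι → Matrix m m ℂ} (hh : ∀ i, h i ∈ unitaryGroup m ℂ) {W : Matrix m m ℂ}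
    (hWu : W ∈ unitaryGroup m ℂ) (hg : ∀ i, ‖h i * star W - 1‖ < 1 / 2) {c : ι → ℝ} (hc0 : ∀ i, 0 ≤ c i)
    (hc1 : ∑ i, c i ≤ 1) (ρ : ι → ℝ) (hρ : ∀ i, ‖mlog (h i * star W)‖ ≤ ρ i) (hρ1 : ∀ i, ρ i ≤ 1)
    (T : lieU m →ₗ[ℝ] lieU m)
    (hT : ∀ X : lieU m, ((T X : lieU m) : Matrix m m ℂ) = star (Kmat h c W) * emlD h c W (W * (X : Matrix m m ℂ))) :
    |LinearMap.det T| ≤ (1 - ∑ i, c i * (1 - ψ (ρ i))) ^ (Fintype.card m ^ 2) := by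
  have hKu' : star (star (Kmat h c W)) * star (Kmat h c W) = 1 := by
    rw [star_star]; exact Matrix.mem_unitaryGroup_iff.mp (kmat_mem_unitaryGroup hh hWu hg c)
  obtain ⟨-, hκ0, -⟩ := kappa_bounds hc0 hc1 (fun i => (norm_nonneg _).trans (hρ i)) hρ1
  refine abs_det_le_pow_card_sq_of_hs_le T hκ0 fun X => ?_
  have hX : ((X : lieU m) : Matrix m m ℂ)ᴴ = -(X : Matrix m m ℂ) := by
    rw [← Matrix.star_eq_conjTranspose]; exact mem_lieU_iff.1 X.2
  rw [hT X, hs_unitary_mul hKu']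
  exact emlD_tangent_upper_bound hh hWu hg hc0 hc1 ρ hρ hρ1 (X : Matrix m m ℂ) hX

/-- ★★★ **THE TWO-SIDED JACOBIAN PINCH ON `𝔲(N)`**: under the hypotheses of `abs_det_leftTangent_le` (radii optional: the guard gives
`ρᵢ = log 2`), `(1 − Σcᵢ)^(N²) ≤ |det T| ≤ 1` — part 1's floor (p616149) and the contraction; both ends are attained at the flat background
`hᵢ = W` (`det_leftTangent_flat`). [folklore] -/
theorem abs_det_leftTangent_pinch {h : ι → Matrix m m ℂ} (hh : ∀ i, h i ∈ unitaryGroup m ℂ) {W : Matrix m m ℂ}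
    (hWu : W ∈ unitaryGroup m ℂ) (hg : ∀ i, ‖h i * star W - 1‖ < 1 / 2) {c : ι → ℝ} (hc0 : ∀ i, 0 ≤ c i)
    (hc1 : ∑ i, c i ≤ 1) (T : lieU m →ₗ[ℝ] lieU m)
    (hT : ∀ X : lieU m, ((T X : lieU m) : Matrix m m ℂ) = star (Kmat h c W) * emlD h c W (W * (X : Matrix m m ℂ))) :
    (1 - ∑ i, c i) ^ (Fintype.card m ^ 2) ≤ |LinearMap.det T| ∧ |LinearMap.det T| ≤ 1 := by
  refine ⟨pow_card_sq_le_abs_det_leftTangent hh hWu hg hc0 hc1 T hT, ?_⟩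
  have hl2 : Real.log 2 ≤ 1 := by have := Real.log_two_lt_d9; linarith
  have hρ : ∀ i, ‖mlog (h i * star W)‖ ≤ Real.log 2 := fun i => (norm_mlog_lt_log_two (hg i)).le
  obtain ⟨-, hκ0, hκ1⟩ := kappa_bounds hc0 hc1 (fun _ => (Real.log_pos one_lt_two).le) (fun _ : ι => hl2)
  exact (abs_det_leftTangent_le hh hWu hg hc0 hc1 (fun _ => Real.log 2) hρ (fun _ => hl2) T hT).trans (pow_le_one₀ hκ0 hκ1)

/-- ★★ **UPPER DETERMINANT BOUND ON `𝔰𝔲(N)`** (exponent `N² − 1`): the same for every `ℝ`-linear endomorphism `T` of `𝔰𝔲(N)` agreeing with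
`K_W* · D K_W (W ·)` (such `T` exist on the `deltaSU` guard, part 2's `exists_leftTangent_lieSU`). [folklore] -/
theorem abs_det_leftTangentSU_le {h : ι → Matrix m m ℂ} (hh : ∀ i, h i ∈ unitaryGroup m ℂ) {W : Matrix m m ℂ}
    (hWu : W ∈ unitaryGroup m ℂ) (hg : ∀ i, ‖h i * star W - 1‖ < 1 / 2) {c : ι → ℝ} (hc0 : ∀ i, 0 ≤ c i)
    (hc1 : ∑ i, c i ≤ 1) (ρ : ι → ℝ) (hρ : ∀ i, ‖mlog (h i * star W)‖ ≤ ρ i) (hρ1 : ∀ i, ρ i ≤ 1)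
    (T : lieSU m →ₗ[ℝ] lieSU m)
    (hT : ∀ X : lieSU m, ((T X : lieSU m) : Matrix m m ℂ) = star (Kmat h c W) * emlD h c W (W * (X : Matrix m m ℂ))) :
    |LinearMap.det T| ≤ (1 - ∑ i, c i * (1 - ψ (ρ i))) ^ (Fintype.card m ^ 2 - 1) := by
  have hKu' : star (star (Kmat h c W)) * star (Kmat h c W) = 1 := by
    rw [star_star]; exact Matrix.mem_unitaryGroup_iff.mp (kmat_mem_unitaryGroup hh hWu hg c)
  obtain ⟨-, hκ0, -⟩ := kappa_bounds hc0 hc1 (fun i => (norm_nonneg _).trans (hρ i)) hρ1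
  refine abs_det_le_pow_card_sq_sub_one_of_hs_le T hκ0 fun X => ?_
  have hX : ((X : lieSU m) : Matrix m m ℂ)ᴴ = -(X : Matrix m m ℂ) := by
    rw [← Matrix.star_eq_conjTranspose]; exact (mem_lieSU_iff.1 X.2).1
  rw [hT X, hs_unitary_mul hKu']
  exact emlD_tangent_upper_bound hh hWu hg hc0 hc1 ρ hρ hρ1 (X : Matrix m m ℂ) hX

/-- ★★★ **THE TWO-SIDED JACOBIAN PINCH ON `𝔰𝔲(N)` AT THE TYPED GUARD** (`W, hᵢ ∈ SU(N)`, `‖hᵢW* − 1‖ < deltaSU = min(1∕3, π∕N)`):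
`(1 − Σcᵢ)^(N² − 1) ≤ |det T| ≤ 1` for every `T` on `𝔰𝔲(N)` agreeing with `K_W* · D K_W (W ·)` — the Haar-Jacobian of the printed fibre map
per bond is PINCHED between `L^{(1−d)(N²−1)}` (at the [B10] slot `1 − Σcᵢ = L^{1−d}`) and `1`. [folklore] -/
theorem abs_det_leftTangentSU_pinch {h : ι → Matrix m m ℂ} (hh : ∀ i, h i ∈ specialUnitaryGroup m ℂ) {W : Matrix m m ℂ}
    (hW : W ∈ specialUnitaryGroup m ℂ) (hg : ∀ i, ‖h i * star W - 1‖ < ExpMeanLog.deltaSU m) {c : ι → ℝ} (hc0 : ∀ i, 0 ≤ c i)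
    (hc1 : ∑ i, c i ≤ 1) (T : lieSU m →ₗ[ℝ] lieSU m)
    (hT : ∀ X : lieSU m, ((T X : lieSU m) : Matrix m m ℂ) = star (Kmat h c W) * emlD h c W (W * (X : Matrix m m ℂ))) :
    (1 - ∑ i, c i) ^ (Fintype.card m ^ 2 - 1) ≤ |LinearMap.det T| ∧ |LinearMap.det T| ≤ 1 := by
  refine ⟨pow_card_sq_sub_one_le_abs_det_leftTangentSU hh hW hg hc0 hc1 T hT, ?_⟩
  have hhu : ∀ i, h i ∈ unitaryGroup m ℂ := fun i => (Matrix.mem_specialUnitaryGroup_iff.mp (hh i)).1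
  have hWu : W ∈ unitaryGroup m ℂ := (Matrix.mem_specialUnitaryGroup_iff.mp hW).1
  have hg' : ∀ i, ‖h i * star W - 1‖ < 1 / 2 := guard_half_of_deltaSU hg
  have hl2 : Real.log 2 ≤ 1 := by have := Real.log_two_lt_d9; linarith
  have hρ : ∀ i, ‖mlog (h i * star W)‖ ≤ Real.log 2 := fun i => (norm_mlog_lt_log_two (hg' i)).le
  obtain ⟨-, hκ0, hκ1⟩ := kappa_bounds hc0 hc1 (fun _ => (Real.log_pos one_lt_two).le) (fun _ : ι => hl2)
  exact (abs_det_leftTangentSU_le hhu hWu hg' hc0 hc1 (fun _ => Real.log 2) hρ (fun _ => hl2) T hT).trans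
    (pow_le_one₀ hκ0 hκ1)

/-- ★★ **TYPED-GUARD READING with `h : ι → SU(N)`, `W : SU(N)`** (the letters of `ExpMeanLog.expMeanLogSU`): the two-sided pinch
`(1 − Σcᵢ)^(N² − 1) ≤ |det T| ≤ 1`, one `W`-uniform statement on the whole guard, every `N`. [folklore] -/
theorem abs_det_leftTangentSU_pinch_specialUnitary {n : Type} [DecidableEq n] [Fintype n] [Nonempty n]
    (h : ι → Matrix.specialUnitaryGroup n ℂ) (W : Matrix.specialUnitaryGroup n ℂ)
    (hg : ∀ i, ‖(h i : Matrix n n ℂ) * star (W : Matrix n n ℂ) - 1‖ < ExpMeanLog.deltaSU n)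
    {c : ι → ℝ} (hc0 : ∀ i, 0 ≤ c i) (hc1 : ∑ i, c i ≤ 1) (T : lieSU n →ₗ[ℝ] lieSU n)
    (hT : ∀ X : lieSU n, ((T X : lieSU n) : Matrix n n ℂ)
      = star (Kmat (fun i => (h i : Matrix n n ℂ)) c W) * emlD (fun i => (h i : Matrix n n ℂ)) c W (W * (X : Matrix n n ℂ))) :
    (1 - ∑ i, c i) ^ (Fintype.card n ^ 2 - 1) ≤ |LinearMap.det T| ∧ |LinearMap.det T| ≤ 1 :=
  abs_det_leftTangentSU_pinch (fun i => (h i).2) W.2 hg hc0 hc1 T hT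

end EML

end Summit.QuantumFields.YangMills.BalabanUVNodes.N08HaarCompatibilityGuardJacobianContractionDet

end
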